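import Literature.NumberTheory.Transcendental.KZCalculusProofs
import Literature.NumberTheory.Transcendental.KZLogCalculusProofs
import Literature.NumberTheory.Transcendental.KZCubicalCalculus
import Literature.NumberTheory.Transcendental.SemialgebraicLineDeriv

/-!
# `StokesGeneration` (stmt-KontsevichZagierPeriods-3586), line `fibrewise_stokes`, stub `stub_zsmulSumCube` (rung 9e, V9)

A `ℤ`-COMBINATION OF CLOSED-CUBE REPRESENTATIONS IS ONE REPRESENTATION. THEOREM D of the line proves
decomposability (hence `of T ∈ relations`) for ONE closed-cube representation with a
separated-variables integrand of value `0`; to phrase it as an instance of the Kontsevich–Zagier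
kernel conjecture for `ℤ`-combinations `Σ εᵢ•[tᵢ]` of such representations (same dimension, same
cube domain), the combination is merged into one representation `[T]` with
`T.integrand = Σ εᵢ tᵢ.integrand` — the registered stub `stub_zsmulSumCube`, proved here.

Proof (bookkeeping in the KZ calculus, rule (1b) only):
* `[σ, k·f] ~ k•[σ, f]` for every integer `k` (`zsmul_of_sub_of_mem_relations`): induction on `k`
  (`Int.induction_on`) using one integrand-additivity move `[σ,(k+1)f] − [σ,k f] − [σ,f]` per step
  and the zero representation at `k = 0` (`KZ.of_mem_relations_of_eqOn_zero`);
* the merged representation `T = [cube, Σ εᵢ tᵢ]` (semialgebraic and integrable as a finite sum of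
  integer multiples) splits as `[T] − [0] − Σᵢ [cube, εᵢ tᵢ] ∈ relations`
  (`KZ.of_sub_of_sub_sum_mem_relations`, iterated integrand additivity), and the pieces are
  reassembled with `AddSubgroup.sum_mem / sub_mem`.

References: M. Kontsevich, D. Zagier, *Periods* (2001), §1.2 rule (1).
-/

noncomputable section

set_option linter.dupNamespace false

namespace Summit.KontsevichZagierPeriods.KontsevichZagierPeriods.Cruxes.StokesGeneration.FibrewiseStokes

open MeasureTheory Set
open Literature.NumberTheory.Transcendental
open Literature.NumberTheory.Transcendental.KZ
open Literature.ModelTheory.ExponentialFields (IsSemialgebraic)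

/-- The integer multiple `[σ, k·f]` of a representation `[σ, f]` exists as a representation (same
domain; the integrand is the product of the semialgebraic constant `k` with `f`). [folklore] -/
theorem exists_constIntMulRep {N : ℕ} (k : ℤ) (t : IntegralRep N) :
    ∃ R : IntegralRep N, R.domain = t.domain ∧ R.integrand = fun x => (k : ℝ) * t.integrand x :=
  ⟨⟨t.domain, fun x => (k : ℝ) * t.integrand x, t.isSemialgebraic_domain,
      (isSemialgebraicFunOn_const_intCast t.isSemialgebraic_domain k).fun_mul
        t.isSemialgebraicFunOn_integrand,
      t.integrableOn.const_mul _⟩, rfl, rfl⟩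

/-- **Integer scaling is integrand additivity**: if `R` has the domain of `t` and integrand `k·f`
on it (`f` the integrand of `t`, `k ∈ ℤ`), then `k•[t] − [R]` is a relation of the KZ calculus
(induction on `k`: one move `[σ,(k+1)f] − [σ,k f] − [σ,f] ∈ integrandAddRel` per step, and
`[σ, 0] ∈ relations` at `k = 0`). [cite: KontsevichZagier2001, §1.2 rule (1)] -/
theorem zsmul_of_sub_of_mem_relations {N : ℕ} (t : IntegralRep N) (k : ℤ) :
    ∀ R : IntegralRep N, R.domain = t.domain →
      EqOn R.integrand (fun x => (k : ℝ) * t.integrand x) t.domain → k • of t - of R ∈ relations := by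
  induction k with
  | zero =>
    intro R hRd hRi
    have hR : of R ∈ relations := of_mem_relations_of_eqOn_zero R fun x hx => by
      have hx' : x ∈ t.domain := hRd ▸ hx
      simpa using hRi hx'
    rw [zero_smul, zero_sub]
    exact relations.neg_mem hR
  | succ i ih =>
    intro R hRd hRi
    obtain ⟨R', hR'd, hR'i⟩ := exists_constIntMulRep (i : ℤ) t
    have h1 : (i : ℤ) • of t - of R' ∈ relations := ih R' hR'd fun x _ => congrFun hR'i x
    have h2 : of R - of R' - of t ∈ relations :=
      integrandAddRel_subset_relations ⟨N, R, R', t, hR'd.trans hRd.symm, hRd.symm, fun x hx => by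
        have hx' : x ∈ t.domain := hRd ▸ hx
        simp only [Pi.add_apply, hR'i, hRi hx']
        push_cast
        ring, rfl⟩
    have : ((i : ℤ) + 1) • of t - of R = ((i : ℤ) • of t - of R') - (of R - of R' - of t) := by
      rw [add_smul, one_smul]
      abel
    rw [this]
    exact relations.sub_mem h1 h2
  | pred i ih =>
    intro R hRd hRi
    obtain ⟨R', hR'd, hR'i⟩ := exists_constIntMulRep (-(i : ℤ)) t
    have h1 : (-(i : ℤ)) • of t - of R' ∈ relations := ih R' hR'd fun x _ => congrFun hR'i x
    have h2 : of R' - of R - of t ∈ relations :=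
      integrandAddRel_subset_relations ⟨N, R', R, t, hRd.trans hR'd.symm, hR'd.symm, fun x hx => by
        have hx' : x ∈ t.domain := hR'd ▸ hx
        simp only [Pi.add_apply, hR'i, hRi hx']
        push_cast
        ring, rfl⟩
    have : (-(i : ℤ) - 1) • of t - of R = ((-(i : ℤ)) • of t - of R') + (of R' - of R - of t) := by
      rw [sub_smul, one_smul]
      abel
    rw [this]
    exact relations.add_mem h1 h2

/-- **A `ℤ`-combination of closed-cube representations of one dimension is one representation**
(registered stub `stub_zsmulSumCube`): for `tᵢ` with domain the closed cube `[0,1]^N` and integers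
`εᵢ`, the representation `T = [[0,1]^N, Σᵢ εᵢ tᵢ.integrand]` satisfies `Σᵢ εᵢ•[tᵢ] − [T] ∈ relations`
(integrand additivity, rule (1b), iterated: `[T] − [0] − Σᵢ [cube, εᵢ tᵢ]`, `εᵢ•[tᵢ] − [cube, εᵢ tᵢ]`
and `[0]` are relations). [cite: KontsevichZagier2001, §1.2 rule (1)] -/
theorem stub_zsmulSumCube :
    ∀ (N S : ℕ) (ε : Fin S → ℤ) (t : Fin S → IntegralRep N),
      (∀ i, (t i).domain = Set.pi Set.univ (fun _ : Fin N => Set.Icc (0:ℝ) 1)) →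
      ∃ T : IntegralRep N, T.domain = Set.pi Set.univ (fun _ : Fin N => Set.Icc (0:ℝ) 1) ∧
        (∀ x ∈ Set.pi Set.univ (fun _ : Fin N => Set.Icc (0:ℝ) 1), T.integrand x = ∑ i, (ε i : ℝ) * (t i).integrand x) ∧
        ∑ i, ε i • of (t i) - of T ∈ relations := by
  intro N S ε t hd
  have hC : IsSemialgebraic ℚ (Set.pi Set.univ (fun _ : Fin N => Set.Icc (0:ℝ) 1)) := by
    rw [← cube_eq_pi]
    exact isSemialgebraic_cube
  have hts : ∀ i, IsSemialgebraicFunOn ℚ (Set.pi Set.univ (fun _ : Fin N => Set.Icc (0:ℝ) 1))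
      (t i).integrand := fun i => hd i ▸ (t i).isSemialgebraicFunOn_integrand
  have hti : ∀ i, IntegrableOn (t i).integrand (Set.pi Set.univ (fun _ : Fin N => Set.Icc (0:ℝ) 1)) :=
    fun i => hd i ▸ (t i).integrableOn
  -- the integer multiples `[cube, εᵢ tᵢ]`
  choose Rs hRsd hRsi using fun i => exists_constIntMulRep (ε i) (t i)
  -- the merged representation `[cube, Σᵢ εᵢ tᵢ]`
  let T : IntegralRep N :=
    { domain := Set.pi Set.univ (fun _ : Fin N => Set.Icc (0:ℝ) 1)
      integrand := fun x => ∑ i, (ε i : ℝ) * (t i).integrand x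
      isSemialgebraic_domain := hC
      isSemialgebraicFunOn_integrand := IsSemialgebraicFunOn.fun_finsetSum _ hC fun i _ =>
        (isSemialgebraicFunOn_const_intCast hC (ε i)).fun_mul (hts i)
      integrableOn := integrable_finsetSum _ fun i _ => (hti i).const_mul _ }
  obtain ⟨z, hzd, hzi⟩ := exists_zeroRep hC
  have h1 : of T - of z - ∑ i, of (Rs i) ∈ relations :=
    of_sub_of_sub_sum_mem_relations S T z Rs hzd (fun i => (hRsd i).trans (hd i)) fun x _ => by
      simp [T, hzi, hRsi]
  have h2 : of z ∈ relations := of_mem_relations_of_eqOn_zero z (by simp [hzi, EqOn])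
  have h3 : ∑ i, (ε i • of (t i) - of (Rs i)) ∈ relations :=
    relations.sum_mem fun i _ =>
      zsmul_of_sub_of_mem_relations (t i) (ε i) (Rs i) (hRsd i) fun x _ => congrFun (hRsi i) x
  refine ⟨T, rfl, fun x _ => rfl, ?_⟩
  have : ∑ i, ε i • of (t i) - of T =
      ∑ i, (ε i • of (t i) - of (Rs i)) - (of T - of z - ∑ i, of (Rs i)) - of z := by
    rw [Finset.sum_sub_distrib]
    abel
  rw [this]
  exact relations.sub_mem (relations.sub_mem h3 h1) h2

end Summit.KontsevichZagierPeriods.KontsevichZagierPeriods.Cruxes.StokesGeneration.FibrewiseStokes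

end
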